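import Summits.AtomisticToContinuum.FouriersLaw.Theorems.PhononMeanFreePathIncoherentChannelTwoHorizonsMean
import Summits.AtomisticToContinuum.FouriersLaw.Theorems.PhononMeanFreePathIncoherentBoundedCorrelationDecay

/-!
# The coherent channel from a SQUARE tail of the forecast norm
# (line `two-horizons-forecast-loss`, crux `IncoherentChannel`, stub group "SquareTail")

Helper file of line `two-horizons-forecast-loss` of crux `PhononMeanFreePath.IncoherentChannel`
(stmt-AtomisticToContinuum-11811), registered stubs `coherent_of_sqTail` and `coherentDephasing_of_sqEnvelope`.

Setting (`Theorems/PhononMeanFreePathDefs`): `S_N(t) = fnorm ω₂ lam β γ T N t = ‖K_t p_N‖²_{L²(μ₀)}` is the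
forecast norm of the far bath momentum of the `(N+1)`-site pinned anharmonic chain with both baths at `T`, and
`r_N(t) = pairCorr … N t = ⟨p_0, K_t p_N⟩_{μ₀}` is the route's end-to-end pair correlation.

The landed composition `twoHorizons_meanChannels` needs the N-uniform envelope `S_N ≤ C(1+t)^{-α}` with `α > 2`
because it bounds `r_N² ≤ T·S_N` (linear in `S`). The NEW INPUT of this file is the time-reversal inequality
`r_N(2t)² ≤ S_N(t)²` (`N ≥ 1`, `t ≥ 0`; hypothesis `hTR`, discharged by the lead from the echo identity and the
left–right reflection), which is QUADRATIC in `S`. Hence the coherent channel closes from a SQUARE tail: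

* `coherent_of_sqTail` — split `(0,∞)` at the causal window `a_N = N^η`; inside, the landed light cone
  `stub_lightCone` gives `r_N² ≤ ε_N` with `N·ε_N·N^η = N^{1+η} ε_N → 0`; beyond, for `N ≥ 1`,
  `r_N(t)² = r_N(2·(t/2))² ≤ S_N(t/2)²`, so `N ∫_{t > N^η} r_N² ≤ N ∫_{t > N^η} S_N(t/2)² → 0` by the square-tail
  hypothesis; the abstract window/tail lemma `twoHorizons_tendsto_mul_integral_of_window_tail` assembles the two
  horizons (fixed-`N` integrability of `r_N²` for every `N` is `IncoherentBounded.rN_sq_integrableOn`).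
* `coherentDephasing_of_sqEnvelope` — the rank-2 crux `CoherentDephasing` (stmt-AtomisticToContinuum-11810) BY NAME
  from `hTR` and an N-uniform envelope `S_N(t) ≤ C(1+t)^{-α}` with only `α > 1` (was `α > 2`): then
  `S_N(t/2)² ≤ (C 2^α)² (1+t)^{-2α}` is integrable and `N ∫_{t>N^η} (1+t)^{-2α} ≲ N^{1+η(1-2α)} → 0` for
  `η = α/(2α-1) ∈ (1/(2α-1), 1)`.

No definition, no `sorry`; inputs: the landed theorems named above, the route Defs vocabulary, Mathlib.
-/

noncomputable section

open MeasureTheory Set Filter Topology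
open scoped NNReal

namespace Summit.AtomisticToContinuum.FouriersLaw.Theorems.PhononMeanFreePath

open Literature.MathematicalPhysics.KineticTheory.HeatConduction

/-- Fixed-`N` integrability of `t ↦ r_N(t)²` on `(0,∞)` for EVERY `N` (including `N = 0`), in the route
vocabulary `pairCorr` (it is `IncoherentBounded.rN_sq_integrableOn`, whose integrand is `pairCorr … N t ^ 2`
definitionally). [folklore] -/
theorem sqTail_pairCorr_sq_integrableOn {ω₂ lam β γ T : ℝ} (hω : 0 < ω₂) (hl : 0 ≤ lam) (hβ : 0 < β)
    (hγ : 0 < γ) (hT : 0 < T) (N : ℕ) :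
    IntegrableOn (fun t : ℝ => (pairCorr ω₂ lam β γ T N t) ^ 2) (Ioi (0 : ℝ)) := by
  simpa only [pairCorr, fcast] using IncoherentBounded.rN_sq_integrableOn hω hl hβ hγ hT N

/-- **Stub `coherent_of_sqTail` (the coherent channel closes from a square tail of the forecast norm).**
At an admissible parameter point: if `r_N(2t)² ≤ S_N(t)²` for `N ≥ 1`, `t ≥ 0` (time reversal) and, for some
`0 < η < 1`, `t ↦ S_N(t/2)²` is integrable on `(0,∞)` for every `N` with `N ∫_{t > N^η} S_N(t/2)² dt → 0`, then
`t ↦ r_N(t)²` is integrable on `(0,∞)` for every `N` and `N ∫₀^∞ r_N(t)² dt → 0`. Inside the causal window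
`(0, N^η]` the light cone `stub_lightCone` bounds `r_N² ≤ ε_N` with `N^{1+η} ε_N → 0`; beyond it
`r_N(t)² ≤ S_N(t/2)²`; the two horizons are assembled by `twoHorizons_tendsto_mul_integral_of_window_tail`.
[folklore] -/
theorem coherent_of_sqTail : ∀ ω₂ lam β γ : ℝ, 0 < ω₂ → 0 < lam → 0 < β → 0 < γ → ∀ T : ℝ, 0 < T → (∀ N : ℕ, 1 ≤ N → ∀ t : ℝ, 0 ≤ t → (pairCorr ω₂ lam β γ T N (2 * t)) ^ 2 ≤ (fnorm ω₂ lam β γ T N t) ^ 2) → (∃ η : ℝ, 0 < η ∧ η < 1 ∧ (∀ N : ℕ, IntegrableOn (fun t => (fnorm ω₂ lam β γ T N (t / 2)) ^ 2) (Ioi (0 : ℝ))) ∧ Tendsto (fun N : ℕ => (N : ℝ) * ∫ t in Ioi ((N : ℝ) ^ η), (fnorm ω₂ lam β γ T N (t / 2)) ^ 2) atTop (𝓝 0)) → (∀ N : ℕ, IntegrableOn (fun t => (pairCorr ω₂ lam β γ T N t) ^ 2) (Ioi (0 : ℝ))) ∧ Tendsto (fun N : ℕ => (N : ℝ) * ∫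 t in Ioi (0 : ℝ), (pairCorr ω₂ lam β γ T N t) ^ 2) atTop (𝓝 0) := by
  intro ω₂ lam β γ hω hl hβ hγ T hT hTR hTail
  obtain ⟨η, hη0, hη1, hSint, hSlim⟩ := hTail
  -- fixed-N integrability of r_N², every N
  have hgint : ∀ N : ℕ, IntegrableOn (fun t : ℝ => (pairCorr ω₂ lam β γ T N t) ^ 2) (Ioi (0 : ℝ)) :=
    fun N => sqTail_pairCorr_sq_integrableOn hω hl.le hβ hγ hT N
  -- the causal window a_N = N^η and the light cone inside it
  obtain ⟨ε, hε, hwin⟩ := stub_lightCone ω₂ lam β γ hω hl hβ hγ T hT η hη0 hη1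
  have ha0 : ∀ N : ℕ, (0 : ℝ) ≤ (N : ℝ) ^ η := fun N => Real.rpow_nonneg (Nat.cast_nonneg N) η
  have hwing : ∀ (N : ℕ) (t : ℝ), 0 < t → t ≤ (N : ℝ) ^ η → |(pairCorr ω₂ lam β γ T N t) ^ 2| ≤ ε N := by
    intro N t ht hta
    have hw := hwin N t ht.le hta
    rw [abs_of_nonneg (sq_nonneg (pairCorr ω₂ lam β γ T N t))]
    linarith [abs_nonneg (commonPast ω₂ lam β γ T N t)]
  have hwg : Tendsto (fun N : ℕ => (N : ℝ) * (ε N * (N : ℝ) ^ η)) atTop (𝓝 0) := by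
    refine hε.congr (fun N => ?_)
    rw [Real.rpow_add' (Nat.cast_nonneg N) (by linarith : (1 : ℝ) + η ≠ 0), Real.rpow_one]
    ring
  -- beyond the window: r_N(t)² = r_N(2(t/2))² ≤ S_N(t/2)² for N ≥ 1
  have htail : ∀ᶠ N : ℕ in atTop, (N : ℝ) * ∫ t in Ioi ((N : ℝ) ^ η), |(pairCorr ω₂ lam β γ T N t) ^ 2| ≤
      (N : ℝ) * ∫ t in Ioi ((N : ℝ) ^ η), (fnorm ω₂ lam β γ T N (t / 2)) ^ 2 := by
    filter_upwards [eventually_ge_atTop 1] with N hN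
    have hsub : Ioi ((N : ℝ) ^ η) ⊆ Ioi (0 : ℝ) := Ioi_subset_Ioi (ha0 N)
    refine mul_le_mul_of_nonneg_left ?_ (Nat.cast_nonneg N)
    refine setIntegral_mono_on ((hgint N).mono_set hsub).abs ((hSint N).mono_set hsub) measurableSet_Ioi
      (fun t ht => ?_)
    have ht0 : (0 : ℝ) < t := (ha0 N).trans_lt ht
    have h := hTR N hN (t / 2) (by linarith)
    rw [show 2 * (t / 2) = t by ring] at h
    rwa [abs_of_nonneg (sq_nonneg (pairCorr ω₂ lam β γ T N t))]
  -- assemble the two horizons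
  exact ⟨hgint, twoHorizons_tendsto_mul_integral_of_window_tail ha0 hgint hwing htail hwg hSlim⟩

/-- **Stub `coherentDephasing_of_sqEnvelope` (`CoherentDephasing`, item stmt-AtomisticToContinuum-11810, from the
time-reversal inequality and an `L²` envelope).** If `r_N(2t)² ≤ S_N(t)²` (`N ≥ 1`, `t ≥ 0`) at every admissible
parameter point and the forecast norm has an N-uniform envelope `S_N(t) ≤ C(1+t)^{-α}` with `α > 1`, then the
route's rank-2 crux `CoherentDephasing` holds: `S_N(t/2)² ≤ (C·2^α)²(1+t)^{-2α}` is an integrable majorant and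
`N ∫_{t > N^η} (1+t)^{-2α} ≤ N (N^η)^{1-2α}/(2α-1) = N^{1-α}/(2α-1) → 0` for `η = α/(2α-1) ∈ (0,1)`, so
`coherent_of_sqTail` applies. [folklore] -/
theorem coherentDephasing_of_sqEnvelope : (∀ ω₂ lam β γ : ℝ, 0 < ω₂ → 0 < lam → 0 < β → 0 < γ → ∀ T : ℝ, 0 < T → ∀ N : ℕ, 1 ≤ N → ∀ t : ℝ, 0 ≤ t → (pairCorr ω₂ lam β γ T N (2 * t)) ^ 2 ≤ (fnorm ω₂ lam β γ T N t) ^ 2) → (∀ ω₂ lam β γ : ℝ, 0 < ω₂ → 0 < lam → 0 < β → 0 < γ → ∀ T : ℝ, 0 < T → ∃ C α : ℝ, 1 < α ∧ ∀ (N : ℕ) (t : ℝ), 0 ≤ t → fnorm ω₂ lam β γ T N t ≤ C * (1 + t) ^ (-α)) → Summit.AtomisticToContinuum.FouriersLaw.Theses.PhononMeanFreePath.CoherentDephasing := by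
  intro hTR hEnv ω₂ lam β γ hω hl hβ hγ T hT
  obtain ⟨C, α, hα, hS⟩ := hEnv ω₂ lam β γ hω hl hβ hγ T hT
  have hS0 : ∀ (N : ℕ) (t : ℝ), 0 ≤ fnorm ω₂ lam β γ T N t := fun N t => fnorm_nonneg ω₂ lam β γ T N t
  -- C ≥ 0 (from `0 ≤ S_0(0) ≤ C`)
  have hC0 : 0 ≤ C := by
    have h := hS 0 0 le_rfl
    simp only [add_zero, Real.one_rpow, mul_one] at h
    exact (hS0 0 0).trans h
  have hs : (1 : ℝ) < 2 * α := by linarith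
  -- the integrable majorant of S_N(t/2)²
  have hmaj : ∀ (N : ℕ) (t : ℝ), 0 ≤ t →
      (fnorm ω₂ lam β γ T N (t / 2)) ^ 2 ≤ (C * (2 : ℝ) ^ α) ^ 2 * (1 + t) ^ (-(2 * α)) := by
    intro N t ht
    have h1 : (0 : ℝ) < (1 + t) / 2 := by linarith
    have hle : (1 + t / 2) ^ (-α) ≤ ((1 + t) / 2) ^ (-α) :=
      Real.rpow_le_rpow_of_nonpos h1 (by linarith) (by linarith)
    have heq : ((1 + t) / 2) ^ (-α) = (2 : ℝ) ^ α * (1 + t) ^ (-α) := by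
      rw [Real.div_rpow (by linarith) (by norm_num), Real.rpow_neg (by norm_num : (0 : ℝ) ≤ 2), div_inv_eq_mul,
        mul_comm]
    have hSt : fnorm ω₂ lam β γ T N (t / 2) ≤ (C * (2 : ℝ) ^ α) * (1 + t) ^ (-α) := by
      calc fnorm ω₂ lam β γ T N (t / 2) ≤ C * (1 + t / 2) ^ (-α) := hS N (t / 2) (by linarith)
        _ ≤ C * ((1 + t) / 2) ^ (-α) := mul_le_mul_of_nonneg_left hle hC0
        _ = (C * (2 : ℝ) ^ α) * (1 + t) ^ (-α) := by rw [heq]; ring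
    have hsq : ((1 + t) ^ (-α)) ^ 2 = (1 + t) ^ (-(2 * α)) := by
      rw [← Real.rpow_two, ← Real.rpow_mul (by linarith : (0 : ℝ) ≤ 1 + t)]
      congr 1
      ring
    calc (fnorm ω₂ lam β γ T N (t / 2)) ^ 2 ≤ ((C * (2 : ℝ) ^ α) * (1 + t) ^ (-α)) ^ 2 :=
          pow_le_pow_left₀ (hS0 N _) hSt 2
      _ = (C * (2 : ℝ) ^ α) ^ 2 * (1 + t) ^ (-(2 * α)) := by rw [mul_pow, hsq]
  have hGint : IntegrableOn (fun t : ℝ => (C * (2 : ℝ) ^ α) ^ 2 * (1 + t) ^ (-(2 * α))) (Ioi (0 : ℝ)) :=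
    (twoHorizons_integrableOn_one_add_rpow_neg hs).const_mul _
  -- measurability and integrability of t ↦ S_N(t/2)²
  have hdiv : Measurable (fun t : ℝ => t / 2) := measurable_id.div_const 2
  have hmeas : ∀ N : ℕ, Measurable (fun t : ℝ => (fnorm ω₂ lam β γ T N (t / 2)) ^ 2) := fun N =>
    ((commonPastBound_measurable_fnorm hω hl.le hβ.le hγ.le hT N).comp hdiv).pow_const 2
  have hSint : ∀ N : ℕ, IntegrableOn (fun t : ℝ => (fnorm ω₂ lam β γ T N (t / 2)) ^ 2) (Ioi (0 : ℝ)) := by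
    intro N
    refine Integrable.mono' hGint (hmeas N).aestronglyMeasurable ?_
    refine (ae_restrict_iff' measurableSet_Ioi).2 (ae_of_all _ fun t (ht : 0 < t) => ?_)
    rw [Real.norm_eq_abs, abs_of_nonneg (sq_nonneg _)]
    exact hmaj N t ht.le
  -- the window exponent η = α/(2α-1) ∈ (0,1) with 1 + η(1-2α) = 1 - α < 0
  obtain ⟨η, hη0, hη1, hexp⟩ : ∃ η : ℝ, 0 < η ∧ η < 1 ∧ 1 + η * (1 - 2 * α) < 0 := by
    have hd : (0 : ℝ) < 2 * α - 1 := by linarith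
    refine ⟨α / (2 * α - 1), div_pos (by linarith) hd, by rw [div_lt_one hd]; linarith, ?_⟩
    have h : α / (2 * α - 1) * (1 - 2 * α) = -α := by
      rw [div_mul_eq_mul_div, div_eq_iff hd.ne']
      ring
    rw [h]
    linarith
  -- the square tail: N ∫_{t > N^η} S_N(t/2)² ≤ (C 2^α)²/(2α-1) · N^{1+η(1-2α)} → 0
  have hSlim : Tendsto (fun N : ℕ => (N : ℝ) * ∫ t in Ioi ((N : ℝ) ^ η), (fnorm ω₂ lam β γ T N (t / 2)) ^ 2)
      atTop (𝓝 0) := by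
    have hlim : Tendsto (fun N : ℕ => (C * (2 : ℝ) ^ α) ^ 2 / (2 * α - 1) * (N : ℝ) ^ (1 + η * (1 - 2 * α)))
        atTop (𝓝 0) := by
      have := (twoHorizons_tendsto_natCast_rpow_of_neg hexp).const_mul ((C * (2 : ℝ) ^ α) ^ 2 / (2 * α - 1))
      rwa [mul_zero] at this
    refine squeeze_zero' (Eventually.of_forall fun N => ?_) ?_ hlim
    · exact mul_nonneg (Nat.cast_nonneg N) (setIntegral_nonneg measurableSet_Ioi fun t _ => sq_nonneg _)
    · filter_upwards [eventually_ge_atTop 1] with N hN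
      have hNpos : (0 : ℝ) < N := by exact_mod_cast Nat.lt_of_lt_of_le Nat.zero_lt_one hN
      have hx : (0 : ℝ) < (N : ℝ) ^ η := Real.rpow_pos_of_pos hNpos η
      have hsub : Ioi ((N : ℝ) ^ η) ⊆ Ioi (0 : ℝ) := Ioi_subset_Ioi hx.le
      have hle : ∫ t in Ioi ((N : ℝ) ^ η), (fnorm ω₂ lam β γ T N (t / 2)) ^ 2 ≤
          ∫ t in Ioi ((N : ℝ) ^ η), (C * (2 : ℝ) ^ α) ^ 2 * (1 + t) ^ (-(2 * α)) :=
        setIntegral_mono_on ((hSint N).mono_set hsub) (hGint.mono_set hsub) measurableSet_Ioi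
          (fun t ht => hmaj N t (hx.le.trans (le_of_lt ht)))
      have htl : ∫ t in Ioi ((N : ℝ) ^ η), (C * (2 : ℝ) ^ α) ^ 2 * (1 + t) ^ (-(2 * α)) ≤
          (C * (2 : ℝ) ^ α) ^ 2 * ((((N : ℝ) ^ η) ^ (1 - 2 * α)) / (2 * α - 1)) := by
        rw [integral_const_mul]
        exact mul_le_mul_of_nonneg_left (twoHorizons_setIntegral_Ioi_one_add_rpow_le hs hx) (sq_nonneg _)
      have hpow : (N : ℝ) * ((N : ℝ) ^ η) ^ (1 - 2 * α) = (N : ℝ) ^ (1 + η * (1 - 2 * α)) := by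
        rw [← Real.rpow_mul hNpos.le, Real.rpow_add hNpos, Real.rpow_one]
      calc (N : ℝ) * ∫ t in Ioi ((N : ℝ) ^ η), (fnorm ω₂ lam β γ T N (t / 2)) ^ 2
          ≤ (N : ℝ) * ((C * (2 : ℝ) ^ α) ^ 2 * ((((N : ℝ) ^ η) ^ (1 - 2 * α)) / (2 * α - 1))) :=
            mul_le_mul_of_nonneg_left (hle.trans htl) hNpos.le
        _ = (C * (2 : ℝ) ^ α) ^ 2 / (2 * α - 1) * ((N : ℝ) * ((N : ℝ) ^ η) ^ (1 - 2 * α)) := by ring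
        _ = (C * (2 : ℝ) ^ α) ^ 2 / (2 * α - 1) * (N : ℝ) ^ (1 + η * (1 - 2 * α)) := by rw [hpow]
  -- stub 1 at this parameter point, then the route decl by name
  obtain ⟨hrint, hrlim⟩ := coherent_of_sqTail ω₂ lam β γ hω hl hβ hγ T hT (hTR ω₂ lam β γ hω hl hβ hγ T hT)
    ⟨η, hη0, hη1, hSint, hSlim⟩
  refine ⟨fun N => ?_, ?_⟩
  · simpa only [pairCorr, fcast] using hrint N
  · simpa only [pairCorr, fcast] using hrlim

end Summit.AtomisticToContinuum.FouriersLaw.Theorems.PhononMeanFreePath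

end
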